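import Mathlib.NumberTheory.Real.GoldenRatio
import Mathlib.Analysis.Complex.Basic
import Mathlib.Analysis.Normed.Group.Basic
import Mathlib.Algebra.BigOperators.Group.Multiset.Basic
import HarnessLib

/-!
# Golden integers both of whose real conjugates are at most `2` in absolute value: Booker's set `A`

A. R. Booker, *A note on Maass forms of icosahedral type*, Math. Z. 292 (2019) 1315–1324
= arXiv:1712.06876 [Booker2018], Theorem 1 and §3.1 (held text `paper:arxiv-1712.06876`,
materialised pp. 3 and 5). Theorem 1 puts `A = {0, ±1, ±2, ±φ, ±φ^τ}`, `φ = (1+√5)/2`, `τ` the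
non-trivial automorphism of `ℚ(φ)`, and its proof opens (§3.1, first paragraph):

> "If `π_p` and `π'_p` are both tempered for some prime `p`, then
> `max{|λ_π(p)|, |λ_π(p)^τ|} ≤ 2`, which holds if and only if `λ_π(p) ∈ A`. Thus, conclusion (2)
> of the theorem implies conclusion (3c)."

This file PROVES that elementary step, in the coordinates used by the route
`Summits/Langlands/Langlands/Theses/E8QuinticResidue.lean` (a Hecke eigenvalue is written
`a + b φ` with `a b : ℤ`, its conjugate `a + b φ^τ = a + b (1 - √5)/2`, and `λ ∈ A` is the case list
`b = 0 ∧ a ∈ {0, ±1, ±2}` (i.e. `λ ∈ {0, ±1, ±2}`), `a = 0 ∧ b = ±1` (`λ = ±φ`),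
`(a, b) = (1, -1)` (`λ = φ^τ = 1 - φ`), `(a, b) = (-1, 1)` (`λ = -φ^τ`)):

* `abs_add_mul_goldenRatio_le_two_iff` — for `a b : ℤ`:
  `|a + bφ| ≤ 2 ∧ |a + bψ| ≤ 2 ↔ a + bφ ∈ A` (real form, `ψ = φ^τ = goldenConj`);
* `norm_add_mul_goldenRatio_le_two_iff` — the same with the complex spellings
  `(a : ℂ) + (b : ℂ) * ((1 + (√5 : ℂ)) / 2)` and `(a : ℂ) + (b : ℂ) * ((1 - (√5 : ℂ)) / 2)` of the
  route file;
* `norm_multiset_sum_le_two_of_norm_eq_one` — a multiset of two unimodular complex numbers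
  (a tempered `GL₂` Satake parameter) has sum of norm `≤ 2`;
* `mem_bookerValueSet_of_tempered` — **Booker §3.1, first paragraph, a.e.-Satake form**: if the
  Satake parameters `α`, `α'` (two entries each) of `π`, `π'` at a place are both unimodular and
  their sums are `a + bφ`, `a + bφ^τ`, then `a + bφ ∈ A` (the case list above).

Proof: both numbers are real; their difference is `b√5`, so `|b| √5 ≤ 4 < 2√5` forces `|b| ≤ 1`,
and then `|a| ≤ 4`; the finitely many remaining pairs are checked against `2 < √5 < 3`.
Everything here is proved (no named facts); Mathlib has `goldenRatio`, `goldenConj` and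
`norm_multiset_sum_le` but no statement about golden integers with bounded conjugates beyond the
tree's `Literature/NumberTheory/ZPhiDiscrete.lean` (finiteness for a general bound `T`, over the
`ZPhi` structure of `GoldenArithmetic`; the explicit list for `T = 2` in the route's `ℤ × ℤ`
coordinates is what is needed here).

## References
* [Booker2018] A. R. Booker, A note on Maass forms of icosahedral type, Math. Z. 292 (2019),
  Theorem 1 (the set `A`) and §3.1, first paragraph.
-/

namespace Literature.NumberTheory.QuadraticFields

open Real

/-- `2 < √5`. [folklore] -/
theorem two_lt_sqrt_five : (2 : ℝ) < √5 := by
  rw [Real.lt_sqrt (by norm_num)]; norm_num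

/-- `√5 < 3`. [folklore] -/
theorem sqrt_five_lt_three : √5 < (3 : ℝ) := by
  rw [Real.sqrt_lt' (by norm_num)]; norm_num

/-- **Golden integers with both conjugates in `[-2, 2]` (Booker's set `A`).** For `a b : ℤ`,
`|a + bφ| ≤ 2` and `|a + bψ| ≤ 2` (`φ = (1+√5)/2`, `ψ = (1-√5)/2 = φ^τ`) hold iff
`a + bφ ∈ A = {0, ±1, ±2, ±φ, ±φ^τ}`, i.e. iff `(a, b)` is one of `(0,0), (±1,0), (±2,0)`,
`(0,±1)`, `(1,-1)`, `(-1,1)`. [cite: Booker2018, §3.1 (first paragraph) and Theorem 1 (the set A)] -/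
theorem abs_add_mul_goldenRatio_le_two_iff (a b : ℤ) :
    (|(a : ℝ) + b * goldenRatio| ≤ 2 ∧ |(a : ℝ) + b * goldenConj| ≤ 2) ↔
      ((b = 0 ∧ (a = 0 ∨ a = 1 ∨ a = -1 ∨ a = 2 ∨ a = -2)) ∨
        (a = 0 ∧ (b = 1 ∨ b = -1)) ∨ (a = 1 ∧ b = -1) ∨ (a = -1 ∧ b = 1)) := by
  have h5 := two_lt_sqrt_five
  have h5' := sqrt_five_lt_three
  dsimp only [goldenRatio, goldenConj]
  constructor
  · rintro ⟨h1, h2⟩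
    rw [abs_le] at h1 h2
    obtain ⟨h1l, h1r⟩ := h1
    obtain ⟨h2l, h2r⟩ := h2
    have hdiff : (b : ℝ) * √5 =
        ((a : ℝ) + b * ((1 + √5) / 2)) - ((a : ℝ) + b * ((1 - √5) / 2)) := by ring
    have hb1 : (b : ℝ) * √5 ≤ 4 := by rw [hdiff]; linarith
    have hb2 : -4 ≤ (b : ℝ) * √5 := by rw [hdiff]; linarith
    have hbu : (b : ℝ) < 2 := lt_of_not_ge fun h => by nlinarith
    have hbl : (-2 : ℝ) < b := lt_of_not_ge fun h => by nlinarith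
    have hbu' : b < 2 := by exact_mod_cast hbu
    have hbl' : -2 < b := by exact_mod_cast hbl
    have hau : (a : ℝ) < 5 := by nlinarith
    have hal : (-5 : ℝ) < a := by nlinarith
    have hau' : a < 5 := by exact_mod_cast hau
    have hal' : -5 < a := by exact_mod_cast hal
    clear hdiff hb1 hb2 hbu hbl hau hal
    interval_cases b <;> interval_cases a
    all_goals push_cast at h1l h1r h2l h2r
    all_goals first | decide | (exfalso; nlinarith)
  · rintro (⟨rfl, h⟩ | ⟨rfl, h⟩ | ⟨rfl, rfl⟩ | ⟨rfl, rfl⟩)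
    · rcases h with rfl | rfl | rfl | rfl | rfl <;> push_cast <;> rw [abs_le, abs_le] <;>
        refine ⟨⟨?_, ?_⟩, ⟨?_, ?_⟩⟩ <;> nlinarith
    · rcases h with rfl | rfl <;> push_cast <;> rw [abs_le, abs_le] <;>
        refine ⟨⟨?_, ?_⟩, ⟨?_, ?_⟩⟩ <;> nlinarith
    · push_cast; rw [abs_le, abs_le]; refine ⟨⟨?_, ?_⟩, ⟨?_, ?_⟩⟩ <;> nlinarith
    · push_cast; rw [abs_le, abs_le]; refine ⟨⟨?_, ?_⟩, ⟨?_, ?_⟩⟩ <;> nlinarith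

/-- The route's complex spelling of `a + bφ` is the real number `a + bφ`. [folklore] -/
theorem intCast_add_mul_goldenRatio_eq_ofReal (a b : ℤ) :
    (a : ℂ) + (b : ℂ) * ((1 + (Real.sqrt 5 : ℂ)) / 2) =
      (((a : ℝ) + b * goldenRatio : ℝ) : ℂ) := by
  dsimp only [goldenRatio]; push_cast; ring

/-- The route's complex spelling of `a + bφ^τ` is the real number `a + bψ`. [folklore] -/
theorem intCast_add_mul_goldenConj_eq_ofReal (a b : ℤ) :
    (a : ℂ) + (b : ℂ) * ((1 - (Real.sqrt 5 : ℂ)) / 2) =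
      (((a : ℝ) + b * goldenConj : ℝ) : ℂ) := by
  dsimp only [goldenConj]; push_cast; ring

/-- **Booker's set `A`, complex form** (the spelling of
`Summits/Langlands/Langlands/Theses/E8QuinticResidue.lean`): for `a b : ℤ`,
`‖a + b(1+√5)/2‖ ≤ 2 ∧ ‖a + b(1-√5)/2‖ ≤ 2` in `ℂ` iff `(a, b)` is in the list of
`abs_add_mul_goldenRatio_le_two_iff`. [cite: Booker2018, §3.1 (first paragraph)] -/
theorem norm_add_mul_goldenRatio_le_two_iff (a b : ℤ) :
    (‖(a : ℂ) + (b : ℂ) * ((1 + (Real.sqrt 5 : ℂ)) / 2)‖ ≤ 2 ∧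
        ‖(a : ℂ) + (b : ℂ) * ((1 - (Real.sqrt 5 : ℂ)) / 2)‖ ≤ 2) ↔
      ((b = 0 ∧ (a = 0 ∨ a = 1 ∨ a = -1 ∨ a = 2 ∨ a = -2)) ∨
        (a = 0 ∧ (b = 1 ∨ b = -1)) ∨ (a = 1 ∧ b = -1) ∨ (a = -1 ∧ b = 1)) := by
  rw [intCast_add_mul_goldenRatio_eq_ofReal, intCast_add_mul_goldenConj_eq_ofReal,
    Complex.norm_real, Complex.norm_real, Real.norm_eq_abs, Real.norm_eq_abs]
  exact abs_add_mul_goldenRatio_le_two_iff a b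

/-- A multiset of two unimodular complex numbers (a tempered `GL₂` Satake parameter) has sum of
norm at most `2`. [folklore] -/
theorem norm_multiset_sum_le_two_of_norm_eq_one (α : Multiset ℂ) (hcard : Multiset.card α = 2)
    (h : ∀ z ∈ α, ‖z‖ = 1) : ‖α.sum‖ ≤ 2 := by
  calc ‖α.sum‖ ≤ (α.map fun z => ‖z‖).sum := norm_multiset_sum_le α
    _ = (α.map fun _ => (1 : ℝ)).sum := by rw [Multiset.map_congr rfl h]
    _ = 2 := by norm_num [hcard]

/-- **Booker 2018, §3.1 (first paragraph), a.e.-Satake form.** If at some place the Satake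
parameters `α` of `π` and `α'` of `π'` (two entries each) are both tempered (all entries of
absolute value `1`) and `λ_π(p) = α.sum = a + bφ`, `λ_{π'}(p) = α'.sum = a + bφ^τ` with
`a b : ℤ`, then `λ_π(p) ∈ A = {0, ±1, ±2, ±φ, ±φ^τ}` — as the case list on `(a, b)`
("`max{|λ_π(p)|, |λ_π(p)^τ|} ≤ 2`, which holds if and only if `λ_π(p) ∈ A`").
[cite: Booker2018, §3.1 (first paragraph)] -/
theorem mem_bookerValueSet_of_tempered (a b : ℤ) (α α' : Multiset ℂ)
    (hα : Multiset.card α = 2) (hα' : Multiset.card α' = 2)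
    (htemp : ∀ z ∈ α, ‖z‖ = 1) (htemp' : ∀ z ∈ α', ‖z‖ = 1)
    (hsum : α.sum = (a : ℂ) + (b : ℂ) * ((1 + (Real.sqrt 5 : ℂ)) / 2))
    (hsum' : α'.sum = (a : ℂ) + (b : ℂ) * ((1 - (Real.sqrt 5 : ℂ)) / 2)) :
    (b = 0 ∧ (a = 0 ∨ a = 1 ∨ a = -1 ∨ a = 2 ∨ a = -2)) ∨
      (a = 0 ∧ (b = 1 ∨ b = -1)) ∨ (a = 1 ∧ b = -1) ∨ (a = -1 ∧ b = 1) := by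
  rw [← norm_add_mul_goldenRatio_le_two_iff, ← hsum, ← hsum']
  exact ⟨norm_multiset_sum_le_two_of_norm_eq_one α hα htemp,
    norm_multiset_sum_le_two_of_norm_eq_one α' hα' htemp'⟩

end Literature.NumberTheory.QuadraticFields
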